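import Mathlib
import HarnessLib
import Summits.HubbardSuperconductivity.HubbardSuperconductivity.Theorems.KLProgrammeKLRegimeEngineTwoLegStepV17F2ClosersDual

/-!
# K3 gen 8, ENGINE child `KLRegimeEngineV17F2` (stmt-HubbardSuperconductivity-20437), stub (e): the closer shells with the package `(G, Q)`, the thresholds
# AND THE READING-JET TABLES `(cJ, cJ')` as binders — v2-ready («JET-TABLE-GENERIC», plan g17 (R47r): token #9′ `klC4aJetC ↦ klC4aJetC2`; «CE-GENERIC», (R47q))

Cell gate-hubbard-kl, seat hubbard-kl-r2d-p1 (g6).  The `_GQ` shells (p534923 / p538113 / p540781) take the package `(G, Q)` as binders but hard-wire c4a-1's table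
`klC4aJetC` in the rows `hGS : ∀ k, klC4aJetC k ≤ G.S k` and `hJ : TwoLegReadJetBound L M klC4aJetC (klC4aJetC' P R) …`.  Skeleton v2 renames the table (token #9′,
k = 2 entry `1 ↦ 2^4`), so here the tables are binders too — `(cJ cJ' : ℕ → ℝ)` with `hGS : ∀ k, cJ k ≤ G.S k`, `hQS : ∀ k, cJ' k ≤ Q.S' k`,
`hJ : TwoLegReadJetBound L M cJ cJ' β U μ (K_n) n` (the door `twoLegStepV17F2_of_jets_sepTubeGradient_nestedLegs_pkg`, p529192, is table-generic already).  None of the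
shells reads `Q.CE` (only `Q.S'`, `Q.CL`, `Q.M0`), so they are CE-generic as (R47q) requires.  Four currencies for residual B, as in the `_GQ` family:

* `stub_twoLeg_step_of_residuals_GQJ` (fits B1–B3), `stub_twoLeg_step_of_engineSizes_GQJ` (sizes `Z, S` within the all-scales allowance),
  `stub_twoLeg_step_of_gridMoments_GQJ` (grid moments of `kernel₂ (W_n[K_n] − 𝒩_{K_n,4M})`), `stub_twoLeg_step_of_dualMoments_GQJ` (dual-lattice moments of the
  trivial-multiplier two-leg kernel of `𝒱⁽ⁿ⁾[K_n] − 𝒩_{K_n}`), each + C1 `hcut` / C2 `hsp` ⇒ `TwoLegStepV17F2 L M G P Q R β U μ n`.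

The v2 literal instance (package `klEngGeo8 / klEngQ8|Q9 / klEngU₀10`, tables `klC4aJetC2 / klC4aJetC'`, plus the ignored v2 hypotheses `hlev`/`LevelsUExportAt`) is ONE line
per shell once the v2 text is rendered.  Proofs only; no definitions; nothing about the model is asserted; nothing asserts superconductivity.
[cite: BenfattoGiulianiMastropietro2006] (§2.4 (2.36)).
-/

noncomputable section

namespace Summit.HubbardSuperconductivity.HubbardSuperconductivity.Theorems.EngineV8

set_option linter.dupNamespace false -- summit = problem name (single-conjunct summit), D-0017

open Real Finset Literature.MathematicalPhysics.QuantumLattice Literature.Probability.LatticeModels GrassmannAlgebra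
open Literature.MathematicalPhysics.QuantumLattice.FermiRG Literature.MathematicalPhysics.QuantumLattice.BandSectorCounting
open Summit.HubbardSuperconductivity.HubbardSuperconductivity.Theorems.KLProgrammeLegKernels
open Summit.HubbardSuperconductivity.HubbardSuperconductivity.Theorems.DispersionFlow
open Summit.HubbardSuperconductivity.HubbardSuperconductivity.Theorems.PerturbedFermiCurve
open Summit.HubbardSuperconductivity.HubbardSuperconductivity.Theorems.KLRegimeSplit
open Summit.HubbardSuperconductivity.HubbardSuperconductivity.Theorems.TwoPointAssembly
open Summit.HubbardSuperconductivity.HubbardSuperconductivity.Theorems.TwoLegFourier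

/-- **STUB (e) MODULO ITS NAMED RESIDUALS — package, thresholds AND jet tables as binders** (fits B1 `hz` · B2 `hm₁'` · B3 `hfit1` + C1/C2). -/
theorem stub_twoLeg_step_of_residuals_GQJ (G : GeoConsts) (Q : EngConsts) (cJ cJ' : ℕ → ℝ) {c₃ U₀c : ℝ} (P : SplitConsts) (R : RenConsts) (c : ℝ)
    (hGS : ∀ k, cJ k ≤ G.S k) (hQS : ∀ k, cJ' k ≤ Q.S' k) (hQCL : ∀ (β : ℝ) (n : ℕ), 0 ≤ Q.CL β n)
    (hc₃ : c₃ ≤ klEngC₃3 P R) (hU₀ : U₀c ≤ klEngU₀4 P R c) (hP : P.WF) (hR : R.WF2) (hc : 0 < c) (hc3 : c ≤ c₃)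
    (μ : ℝ) (hμ : μ ∈ klWindowC) (U : ℝ) (hU : 0 < U) (hUle : U ≤ U₀c) (β : ℝ) (hβ : klBetaMin ≤ β) (hβc : β ≤ Real.exp (c / U ^ 2))
    (L M : ℕ) [NeZero L] [NeZero M] (hL : klEngL₃ β U ≤ L) (hM : klEngM₃ β U L ≤ M)
    (n : ℕ) (hn1 : 1 ≤ n) (hn : n ≤ nScales β + 1) (hreg : IsKLRegime U c (-(n : ℤ)))
    (hhist : HistP klPredsV17F2 L M G P Q R β U μ 0 n)
    (hfr : FrameOK R U (nScales β) μ (klFlowFrameU L M β U μ n))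
    (hE : EngineBoundsAtV17F2 L M G P Q β U μ n)
    (hJ : TwoLegReadJetBound L M cJ cJ' β U μ (klFlowFrameU L M β U μ n) n)
    (hz : ∀ k ∈ klShell L μ (klFlowFrameU L M β U μ n) n, |klFieldStrength L M β U μ (klFlowFrameU L M β U μ n) n k - 1| ≤ R.cz * |U|)
    {m₁' : ℝ}
    (hm₁' : ∀ q : Momentum, |frameLevel μ (klFlowFrameU L M β U μ n) q| ≤ klScale klE0 n →
      ‖fderiv ℝ (evalM (symInterp L (fun p => klLocSelfEnergyRe L M β U μ (klFlowFrameU L M β U μ n) n p -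
        (klFlowFrameU L M β U μ n).eval (latticeMomentum L p)))) q‖ ≤ m₁')
    (hfit1 : m₁' + 4 / 3 * R.Gfr 1 * U ^ 2 ≤ R.cz * |U| * (cDtmin (-1.2) (-0.05) / 2))
    (hcut : ∀ (Mq : ℕ → ℕ) (L₁ M₁ M₂ : ℕ) [NeZero L₁] [NeZero M₁] [NeZero M₂], L ≤ L₁ → Q.M0 β L₁ ≤ M₁ → Mq L₁ ≤ M₁ → M₁ ≤ M₂ →
      (∀ j < n, histV17F2 L₁ M₁ G P Q R β U μ j ∧ TwoLegSlopes L₁ M₁ R β U μ (klFlowFrameU L₁ M₁ β U μ j) j) →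
      (∀ j < n, histV17F2 L₁ M₂ G P Q R β U μ j ∧ TwoLegSlopes L₁ M₂ R β U μ (klFlowFrameU L₁ M₂ β U μ j) j) →
        ∀ θ : ℝ, |klLocalPart L₁ M₁ β U μ (klFlowFrameU L₁ M₁ β U μ n) n θ -
          klLocalPart L₁ M₂ β U μ (klFlowFrameU L₁ M₂ β U μ n) n θ| ≤ Q.CL β n / 4 / L₁)
    (hsp : ∀ (Mq : ℕ → ℕ) (L₁ L₂ M₂ : ℕ) [NeZero L₁] [NeZero L₂] [NeZero M₂], L ≤ L₁ → L₁ ∣ L₂ → Q.M0 β L₁ ≤ M₂ → Mq L₁ ≤ M₂ →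
      Q.M0 β L₂ ≤ M₂ → Mq L₂ ≤ M₂ →
      (∀ j < n, histV17F2 L₁ M₂ G P Q R β U μ j ∧ TwoLegSlopes L₁ M₂ R β U μ (klFlowFrameU L₁ M₂ β U μ j) j) →
      (∀ j < n, histV17F2 L₂ M₂ G P Q R β U μ j ∧ TwoLegSlopes L₂ M₂ R β U μ (klFlowFrameU L₂ M₂ β U μ j) j) →
        ∀ θ : ℝ, |klLocalPart L₁ M₂ β U μ (klFlowFrameU L₁ M₂ β U μ n) n θ -
          klLocalPart L₂ M₂ β U μ (klFlowFrameU L₂ M₂ β U μ n) n θ| ≤ Q.CL β n / 4 / L₁) :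
    TwoLegStepV17F2 L M G P Q R β U μ n := by
  have _ := hP; have _ := hM; have _ := hn1; have _ := hreg; have _ := hhist; have _ := hE
  exact twoLegStepV17F2_of_jets_sepTubeGradient_nestedLegs_pkg G Q P hR hc (hc3.trans hc₃) hμ hU (hUle.trans hU₀) hβ hβc hL hn hfr (hQCL β n)
    hGS hQS hJ.1 hJ.2 hz hm₁' hfit1 hcut hsp

/-- **STUB (e) MODULO ENGINE SIZES — package, thresholds AND jet tables as binders** (B1′ `hzZ`, B2′ `hmS`, `Z, S` within the all-scales allowance + C1/C2). -/
theorem stub_twoLeg_step_of_engineSizes_GQJ (G : GeoConsts) (Q : EngConsts) (cJ cJ' : ℕ → ℝ) {c₃ U₀c : ℝ} (P : SplitConsts) (R : RenConsts) (c : ℝ)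
    (hGS : ∀ k, cJ k ≤ G.S k) (hQS : ∀ k, cJ' k ≤ Q.S' k) (hQCL : ∀ (β : ℝ) (n : ℕ), 0 ≤ Q.CL β n)
    (hc₃ : c₃ ≤ klEngC₃3 P R) (hU₀ : U₀c ≤ klEngU₀4 P R c) (hU₀all : U₀c ≤ klE3U₀all R) (hP : P.WF) (hR : R.WF2) (hc : 0 < c) (hc3 : c ≤ c₃)
    (μ : ℝ) (hμ : μ ∈ klWindowC) (U : ℝ) (hU : 0 < U) (hUle : U ≤ U₀c) (β : ℝ) (hβ : klBetaMin ≤ β) (hβc : β ≤ Real.exp (c / U ^ 2))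
    (L M : ℕ) [NeZero L] [NeZero M] (hL : klEngL₃ β U ≤ L) (hM : klEngM₃ β U L ≤ M)
    (n : ℕ) (hn1 : 1 ≤ n) (hn : n ≤ nScales β + 1) (hreg : IsKLRegime U c (-(n : ℤ)))
    (hhist : HistP klPredsV17F2 L M G P Q R β U μ 0 n)
    (hfr : FrameOK R U (nScales β) μ (klFlowFrameU L M β U μ n))
    (hE : EngineBoundsAtV17F2 L M G P Q β U μ n)
    (hJ : TwoLegReadJetBound L M cJ cJ' β U μ (klFlowFrameU L M β U μ n) n)
    {Z S : ℝ} (hZ : Z ≤ (2 : ℝ) ^ 10 * Real.exp 1 ^ 18 * Real.sqrt (2 * (7 + 1606732)) ^ 4 * klE3Acum R)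
    (hS : S ≤ (2 : ℝ) ^ 11 * Real.exp 1 ^ 18 * Real.sqrt (2 * (7 + 1606732)) ^ 4 * klE3Acum R)
    (hzZ : ∀ k ∈ klShell L μ (klFlowFrameU L M β U μ n) n, |klFieldStrength L M β U μ (klFlowFrameU L M β U μ n) n k - 1| ≤ Z * U ^ 2)
    (hmS : ∀ q : Momentum, |frameLevel μ (klFlowFrameU L M β U μ n) q| ≤ klScale klE0 n →
      ‖fderiv ℝ (evalM (symInterp L (fun p => klLocSelfEnergyRe L M β U μ (klFlowFrameU L M β U μ n) n p -
        (klFlowFrameU L M β U μ n).eval (latticeMomentum L p)))) q‖ ≤ S * U ^ 2)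
    (hcut : ∀ (Mq : ℕ → ℕ) (L₁ M₁ M₂ : ℕ) [NeZero L₁] [NeZero M₁] [NeZero M₂], L ≤ L₁ → Q.M0 β L₁ ≤ M₁ → Mq L₁ ≤ M₁ → M₁ ≤ M₂ →
      (∀ j < n, histV17F2 L₁ M₁ G P Q R β U μ j ∧ TwoLegSlopes L₁ M₁ R β U μ (klFlowFrameU L₁ M₁ β U μ j) j) →
      (∀ j < n, histV17F2 L₁ M₂ G P Q R β U μ j ∧ TwoLegSlopes L₁ M₂ R β U μ (klFlowFrameU L₁ M₂ β U μ j) j) →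
        ∀ θ : ℝ, |klLocalPart L₁ M₁ β U μ (klFlowFrameU L₁ M₁ β U μ n) n θ -
          klLocalPart L₁ M₂ β U μ (klFlowFrameU L₁ M₂ β U μ n) n θ| ≤ Q.CL β n / 4 / L₁)
    (hsp : ∀ (Mq : ℕ → ℕ) (L₁ L₂ M₂ : ℕ) [NeZero L₁] [NeZero L₂] [NeZero M₂], L ≤ L₁ → L₁ ∣ L₂ → Q.M0 β L₁ ≤ M₂ → Mq L₁ ≤ M₂ →
      Q.M0 β L₂ ≤ M₂ → Mq L₂ ≤ M₂ →
      (∀ j < n, histV17F2 L₁ M₂ G P Q R β U μ j ∧ TwoLegSlopes L₁ M₂ R β U μ (klFlowFrameU L₁ M₂ β U μ j) j) →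
      (∀ j < n, histV17F2 L₂ M₂ G P Q R β U μ j ∧ TwoLegSlopes L₂ M₂ R β U μ (klFlowFrameU L₂ M₂ β U μ j) j) →
        ∀ θ : ℝ, |klLocalPart L₁ M₂ β U μ (klFlowFrameU L₁ M₂ β U μ n) n θ -
          klLocalPart L₂ M₂ β U μ (klFlowFrameU L₂ M₂ β U μ n) n θ| ≤ Q.CL β n / 4 / L₁) :
    TwoLegStepV17F2 L M G P Q R β U μ n := by
  have _ := hP; have _ := hM; have _ := hn1; have _ := hreg; have _ := hhist; have _ := hE
  have hUall : U ≤ klE3U₀all R := hUle.trans hU₀all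
  exact twoLegStepV17F2_of_jets_sepTubeGradient_nestedLegs_pkg G Q P hR hc (hc3.trans hc₃) hμ hU (hUle.trans hU₀) hβ hβc hL hn hfr (hQCL β n)
    hGS hQS hJ.1 hJ.2 (fun k hk => fieldStrength_fit_of_size hR.2.2 hU hUall hZ (hzZ k hk)) hmS (slope_fit_of_size hR.2.2 hU hUall hS) hcut hsp

/-- **STUB (e) WITH RESIDUAL B IN GRID-MOMENT CURRENCY — package, thresholds AND jet tables as binders** (`hBt`, `hB1` on `kernel₂ (W_n[K_n] − 𝒩_{K_n,4M})`,
conversions, allowances + C1/C2). -/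
theorem stub_twoLeg_step_of_gridMoments_GQJ (G : GeoConsts) (Q : EngConsts) (cJ cJ' : ℕ → ℝ) {c₃ U₀c : ℝ} (P : SplitConsts) (R : RenConsts) (c : ℝ)
    (hGS : ∀ k, cJ k ≤ G.S k) (hQS : ∀ k, cJ' k ≤ Q.S' k) (hQCL : ∀ (β : ℝ) (n : ℕ), 0 ≤ Q.CL β n)
    (hc₃ : c₃ ≤ klEngC₃3 P R) (hU₀ : U₀c ≤ klEngU₀4 P R c) (hU₀all : U₀c ≤ klE3U₀all R) (hP : P.WF) (hR : R.WF2) (hc : 0 < c) (hc3 : c ≤ c₃)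
    (μ : ℝ) (hμ : μ ∈ klWindowC) (U : ℝ) (hU : 0 < U) (hUle : U ≤ U₀c) (β : ℝ) (hβ : klBetaMin ≤ β) (hβc : β ≤ Real.exp (c / U ^ 2))
    (L M : ℕ) [NeZero L] [NeZero M] (hL : klEngL₃ β U ≤ L) (hM : klEngM₃ β U L ≤ M)
    (n : ℕ) (hn1 : 1 ≤ n) (hn : n ≤ nScales β + 1) (hreg : IsKLRegime U c (-(n : ℤ)))
    (hhist : HistP klPredsV17F2 L M G P Q R β U μ 0 n)
    (hfr : FrameOK R U (nScales β) μ (klFlowFrameU L M β U μ n))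
    (hE : EngineBoundsAtV17F2 L M G P Q β U μ n)
    (hJ : TwoLegReadJetBound L M cJ cJ' β U μ (klFlowFrameU L M β U μ n) n)
    {Bt B₁ Z S : ℝ}
    (hBt : ∀ (σ : Fin 2) (p₀ : GridPoint L (2 * (2 * M))), ∑ p₁ : GridPoint L (2 * (2 * M)),
      β / ((2 * (2 * M) : ℕ) : ℝ) * (circDist (2 * (2 * M)) p₀.1.val p₁.1.val : ℝ) *
        ‖kernel ℂ
          (effAction ℂ ((hubbardGridSub L M β (2 * (2 * M))).transpose *
              hubbardCovAboveCT L M β μ 0 (klFlowFrameU L M β U μ n) (klScale klE0 n) * hubbardGridSub L M β (2 * (2 * M)))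
            (hubbardGridInteraction L (2 * (2 * M)) β U + hubbardGridCounterQuadratic L (2 * (2 * M)) β (klFlowFrameU L M β U μ n)) -
            hubbardGridCounterQuadratic L (2 * (2 * M)) β (klFlowFrameU L M β U μ n)) 2
          (fun i => ((![p₀, p₁] i, σ), i))‖ ≤ Bt)
    (hB1 : ∀ (σ : Fin 2) (p₀ : GridPoint L (2 * (2 * M))), ∑ p₁ : GridPoint L (2 * (2 * M)),
      (if p₁.2 - p₀.2 = 0 then (0 : ℝ) else
        (1 + (((p₁.2 - p₀.2) 0).valMinAbs.natAbs : ℝ) + (((p₁.2 - p₀.2) 1).valMinAbs.natAbs : ℝ)) ^ 1) *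
        ‖kernel ℂ
          (effAction ℂ ((hubbardGridSub L M β (2 * (2 * M))).transpose *
              hubbardCovAboveCT L M β μ 0 (klFlowFrameU L M β U μ n) (klScale klE0 n) * hubbardGridSub L M β (2 * (2 * M)))
            (hubbardGridInteraction L (2 * (2 * M)) β U + hubbardGridCounterQuadratic L (2 * (2 * M)) β (klFlowFrameU L M β U μ n)) -
            hubbardGridCounterQuadratic L (2 * (2 * M)) β (klFlowFrameU L M β U μ n)) 2
          (fun i => ((![p₀, p₁] i, σ), i))‖ ≤ B₁)
    (hZ : 2 * ((2 * (2 * M) : ℕ) : ℝ) / β * Bt ≤ Z * U ^ 2) (hS : 2 * ((2 * (2 * M) : ℕ) : ℝ) / β * B₁ ≤ S * U ^ 2)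
    (hZa : Z ≤ (2 : ℝ) ^ 10 * Real.exp 1 ^ 18 * Real.sqrt (2 * (7 + 1606732)) ^ 4 * klE3Acum R)
    (hSa : S ≤ (2 : ℝ) ^ 11 * Real.exp 1 ^ 18 * Real.sqrt (2 * (7 + 1606732)) ^ 4 * klE3Acum R)
    (hcut : ∀ (Mq : ℕ → ℕ) (L₁ M₁ M₂ : ℕ) [NeZero L₁] [NeZero M₁] [NeZero M₂], L ≤ L₁ → Q.M0 β L₁ ≤ M₁ → Mq L₁ ≤ M₁ → M₁ ≤ M₂ →
      (∀ j < n, histV17F2 L₁ M₁ G P Q R β U μ j ∧ TwoLegSlopes L₁ M₁ R β U μ (klFlowFrameU L₁ M₁ β U μ j) j) →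
      (∀ j < n, histV17F2 L₁ M₂ G P Q R β U μ j ∧ TwoLegSlopes L₁ M₂ R β U μ (klFlowFrameU L₁ M₂ β U μ j) j) →
        ∀ θ : ℝ, |klLocalPart L₁ M₁ β U μ (klFlowFrameU L₁ M₁ β U μ n) n θ -
          klLocalPart L₁ M₂ β U μ (klFlowFrameU L₁ M₂ β U μ n) n θ| ≤ Q.CL β n / 4 / L₁)
    (hsp : ∀ (Mq : ℕ → ℕ) (L₁ L₂ M₂ : ℕ) [NeZero L₁] [NeZero L₂] [NeZero M₂], L ≤ L₁ → L₁ ∣ L₂ → Q.M0 β L₁ ≤ M₂ → Mq L₁ ≤ M₂ →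
      Q.M0 β L₂ ≤ M₂ → Mq L₂ ≤ M₂ →
      (∀ j < n, histV17F2 L₁ M₂ G P Q R β U μ j ∧ TwoLegSlopes L₁ M₂ R β U μ (klFlowFrameU L₁ M₂ β U μ j) j) →
      (∀ j < n, histV17F2 L₂ M₂ G P Q R β U μ j ∧ TwoLegSlopes L₂ M₂ R β U μ (klFlowFrameU L₂ M₂ β U μ j) j) →
        ∀ θ : ℝ, |klLocalPart L₁ M₂ β U μ (klFlowFrameU L₁ M₂ β U μ n) n θ -
          klLocalPart L₂ M₂ β U μ (klFlowFrameU L₂ M₂ β U μ n) n θ| ≤ Q.CL β n / 4 / L₁) :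
    TwoLegStepV17F2 L M G P Q R β U μ n := by
  have hβ0 : 0 < β := lt_of_lt_of_le (by norm_num [klBetaMin]) hβ
  have hzZ : ∀ k ∈ klShell L μ (klFlowFrameU L M β U μ n) n,
      |klFieldStrength L M β U μ (klFlowFrameU L M β U μ n) n k - 1| ≤ Z * U ^ 2 := fun k _ =>
    (abs_klFieldStrength_sub_one_le_of_grid_time_moment_sub_counter_scale hβ0 U μ (klFlowFrameU L M β U μ n) n k hBt).trans hZ
  have hmS : ∀ q : Momentum, |frameLevel μ (klFlowFrameU L M β U μ n) q| ≤ klScale klE0 n →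
      ‖fderiv ℝ (evalM (symInterp L (fun p => klLocSelfEnergyRe L M β U μ (klFlowFrameU L M β U μ n) n p -
        (klFlowFrameU L M β U μ n).eval (latticeMomentum L p)))) q‖ ≤ S * U ^ 2 := fun q _ => by
    have h := twoLeg_sep_fderiv_of_grid_scale hβ0.ne' U μ (klFlowFrameU L M β U μ n) n hB1 q
    rw [two_mul_card_gridPoint_div hβ0] at h
    exact h.trans hS
  exact stub_twoLeg_step_of_engineSizes_GQJ G Q cJ cJ' P R c hGS hQS hQCL hc₃ hU₀ hU₀all hP hR hc hc3 μ hμ U hU hUle β hβ hβc L M hL hM n hn1 hn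
    hreg hhist hfr hE hJ hZa hSa hzZ hmS hcut hsp

/-- **STUB (e) WITH RESIDUAL B IN DUAL-LATTICE MOMENT CURRENCY — package, thresholds AND jet tables as binders** (`hMt`, `hMs` on the trivial-multiplier
two-leg kernel of `𝒱⁽ⁿ⁾[K_n] − 𝒩_{K_n}`, conversions, allowances + C1/C2). -/
theorem stub_twoLeg_step_of_dualMoments_GQJ (G : GeoConsts) (Q : EngConsts) (cJ cJ' : ℕ → ℝ) {c₃ U₀c : ℝ} (P : SplitConsts) (R : RenConsts) (c : ℝ)
    (hGS : ∀ k, cJ k ≤ G.S k) (hQS : ∀ k, cJ' k ≤ Q.S' k) (hQCL : ∀ (β : ℝ) (n : ℕ), 0 ≤ Q.CL β n)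
    (hc₃ : c₃ ≤ klEngC₃3 P R) (hU₀ : U₀c ≤ klEngU₀4 P R c) (hU₀all : U₀c ≤ klE3U₀all R) (hP : P.WF) (hR : R.WF2) (hc : 0 < c) (hc3 : c ≤ c₃)
    (μ : ℝ) (hμ : μ ∈ klWindowC) (U : ℝ) (hU : 0 < U) (hUle : U ≤ U₀c) (β : ℝ) (hβ : klBetaMin ≤ β) (hβc : β ≤ Real.exp (c / U ^ 2))
    (L M : ℕ) [NeZero L] [NeZero M] (hL : klEngL₃ β U ≤ L) (hM : klEngM₃ β U L ≤ M)
    (n : ℕ) (hn1 : 1 ≤ n) (hn : n ≤ nScales β + 1) (hreg : IsKLRegime U c (-(n : ℤ)))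
    (hhist : HistP klPredsV17F2 L M G P Q R β U μ 0 n)
    (hfr : FrameOK R U (nScales β) μ (klFlowFrameU L M β U μ n))
    (hE : EngineBoundsAtV17F2 L M G P Q β U μ n)
    (hJ : TwoLegReadJetBound L M cJ cJ' β U μ (klFlowFrameU L M β U μ n) n)
    {Mt Ms Z S : ℝ}
    (hMt : ∀ (σ : Fin 2) (x₀ : SpaceTimeIdx L M), imagTimeWeight β M *
      ∑ x ∈ (univ : Finset (Fin 2 → SpaceTimeIdx L M)).filter (fun x => x 0 = x₀),
        imagTimeWeight β M * (circDist (2 * M) (x 0).1.val (x 1).1.val : ℝ) *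
          ‖sectorisedKernel L M β (trivialMultiplier L M)
            (klEffectiveAction L M β U μ (klFlowFrameU L M β U μ n) klE0 n - counterQuadratic L M β (klFlowFrameU L M β U μ n)) 2
            (![((0, σ), 0), ((0, σ), 1)] : Fin 2 → SectorLeg 1) x‖ ≤ Mt)
    (hMs : ∀ (σ : Fin 2) (x₀ : SpaceTimeIdx L M), imagTimeWeight β M *
      ∑ x ∈ (univ : Finset (Fin 2 → SpaceTimeIdx L M)).filter (fun x => x 0 = x₀ ∧ (x 1).2 ≠ (x 0).2),
        (1 + ((((x 1).2 - (x 0).2) 0).valMinAbs.natAbs : ℝ) + ((((x 1).2 - (x 0).2) 1).valMinAbs.natAbs : ℝ)) ^ 1 *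
          ‖sectorisedKernel L M β (trivialMultiplier L M)
            (klEffectiveAction L M β U μ (klFlowFrameU L M β U μ n) klE0 n - counterQuadratic L M β (klFlowFrameU L M β U μ n)) 2
            (![((0, σ), 0), ((0, σ), 1)] : Fin 2 → SectorLeg 1) x‖ ≤ Ms)
    (hZ : 2 * Mt ≤ Z * U ^ 2) (hS : 2 * Ms ≤ S * U ^ 2)
    (hZa : Z ≤ (2 : ℝ) ^ 10 * Real.exp 1 ^ 18 * Real.sqrt (2 * (7 + 1606732)) ^ 4 * klE3Acum R)
    (hSa : S ≤ (2 : ℝ) ^ 11 * Real.exp 1 ^ 18 * Real.sqrt (2 * (7 + 1606732)) ^ 4 * klE3Acum R)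
    (hcut : ∀ (Mq : ℕ → ℕ) (L₁ M₁ M₂ : ℕ) [NeZero L₁] [NeZero M₁] [NeZero M₂], L ≤ L₁ → Q.M0 β L₁ ≤ M₁ → Mq L₁ ≤ M₁ → M₁ ≤ M₂ →
      (∀ j < n, histV17F2 L₁ M₁ G P Q R β U μ j ∧ TwoLegSlopes L₁ M₁ R β U μ (klFlowFrameU L₁ M₁ β U μ j) j) →
      (∀ j < n, histV17F2 L₁ M₂ G P Q R β U μ j ∧ TwoLegSlopes L₁ M₂ R β U μ (klFlowFrameU L₁ M₂ β U μ j) j) →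
        ∀ θ : ℝ, |klLocalPart L₁ M₁ β U μ (klFlowFrameU L₁ M₁ β U μ n) n θ -
          klLocalPart L₁ M₂ β U μ (klFlowFrameU L₁ M₂ β U μ n) n θ| ≤ Q.CL β n / 4 / L₁)
    (hsp : ∀ (Mq : ℕ → ℕ) (L₁ L₂ M₂ : ℕ) [NeZero L₁] [NeZero L₂] [NeZero M₂], L ≤ L₁ → L₁ ∣ L₂ → Q.M0 β L₁ ≤ M₂ → Mq L₁ ≤ M₂ →
      Q.M0 β L₂ ≤ M₂ → Mq L₂ ≤ M₂ →
      (∀ j < n, histV17F2 L₁ M₂ G P Q R β U μ j ∧ TwoLegSlopes L₁ M₂ R β U μ (klFlowFrameU L₁ M₂ β U μ j) j) →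
      (∀ j < n, histV17F2 L₂ M₂ G P Q R β U μ j ∧ TwoLegSlopes L₂ M₂ R β U μ (klFlowFrameU L₂ M₂ β U μ j) j) →
        ∀ θ : ℝ, |klLocalPart L₁ M₂ β U μ (klFlowFrameU L₁ M₂ β U μ n) n θ -
          klLocalPart L₂ M₂ β U μ (klFlowFrameU L₂ M₂ β U μ n) n θ| ≤ Q.CL β n / 4 / L₁) :
    TwoLegStepV17F2 L M G P Q R β U μ n := by
  have hβ0 : 0 < β := lt_of_lt_of_le (by norm_num [klBetaMin]) hβ
  have hzZ : ∀ k ∈ klShell L μ (klFlowFrameU L M β U μ n) n,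
      |klFieldStrength L M β U μ (klFlowFrameU L M β U μ n) n k - 1| ≤ Z * U ^ 2 := fun k _ =>
    (abs_klFieldStrength_sub_one_le_of_dual_time_moment_sub_counter hβ0 U μ (klFlowFrameU L M β U μ n) n k hMt).trans hZ
  have hmS : ∀ q : Momentum, |frameLevel μ (klFlowFrameU L M β U μ n) q| ≤ klScale klE0 n →
      ‖fderiv ℝ (evalM (symInterp L (fun p => klLocSelfEnergyRe L M β U μ (klFlowFrameU L M β U μ n) n p -
        (klFlowFrameU L M β U μ n).eval (latticeMomentum L p)))) q‖ ≤ S * U ^ 2 := fun q _ =>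
    (twoLeg_sep_fderiv_of_dual_offDiag_moment hβ0 U μ (klFlowFrameU L M β U μ n) n hMs q).trans hS
  exact stub_twoLeg_step_of_engineSizes_GQJ G Q cJ cJ' P R c hGS hQS hQCL hc₃ hU₀ hU₀all hP hR hc hc3 μ hμ U hU hUle β hβ hβc L M hL hM n hn1 hn
    hreg hhist hfr hE hJ hZa hSa hzZ hmS hcut hsp

end Summit.HubbardSuperconductivity.HubbardSuperconductivity.Theorems.EngineV8

end
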